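import Summits.AnomalousDissipation.AnomalousDissipation.Theorems.SoloInformedLongTimeOnsager
import HarnessLib

/-!
# Quantitative long-time Onsager singularity: the Besov slope of a dissipating family grows like
# `ν^{-(3σ-1)/(σ+1)}` (solo-informed, part 3)

A quantitative companion of `SoloInformedOnsagerSingularWitness`.  By
`lerayHopf_meanDissipation_le_rpow'` (`SoloInformedLongTimeOnsager`), a global Leray–Hopf solution
on `T^d` with steady smooth divergence-free force `f`, viscosity `0 < ν ≤ (1/4)^{σ+1}` and
`‖u‖³_{L³(0,T;B^σ_{3,∞})} ≤ AT + B` for all `T > 0` (`1/3 < σ ≤ 1`, `A ≥ 0`) has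
`⟨ν‖∇u‖₂²⟩ ≤ (K₀ + K₁A) ν^{p}`, `p = (3σ-1)/(σ+1)`, `K₀ = d²C₁² + 2d‖f‖_{B^σ_{2,∞}}`,
`K₁ = 2d²C₁ + d²C₁² + 2d‖f‖_{B^σ_{2,∞}}`.  Read contrapositively:

* `lerayHopf_besov_slope_lower_bound` — if `⟨ν‖∇u‖₂²⟩ ≥ ε` then every admissible slope `A ≥ 0`
  satisfies `K₀ + K₁A ≥ ε ν^{-p}`;
* `lerayHopf_eventually_exceeds_slope` — hence for every slope `A` with `K₀ + K₁ max(A,0) < ε ν^{-p}`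
  and every `B` there is a window `[0,T]` with `u ∉ L³(0,T;B^σ_{3,∞})` or
  `‖u‖³_{L³(0,T;B^σ_{3,∞})} > AT + B`: along a witness of the zeroth law (`ε` fixed, `ν_j → 0`) the
  long-time cubic `B^σ_{3,∞}` mean must grow at least like `(ε ν_j^{-p} - K₀)/K₁`.

Reference: T. D. Drivas, G. L. Eyink, Nonlinearity 32 (2019) 4465–4482, Lemma 1 [DrivasEyink2019]
(finite window; the long-time transport is `SoloInformedLongTimeOnsager`).
-/

noncomputable section

open MeasureTheory Filter Topology Set Function
open scoped ENNReal NNReal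

namespace Summit.AnomalousDissipation.AnomalousDissipation.Theorems

open Literature.Analysis Literature.Analysis.FunctionSpaces Literature.Analysis.FluidPDE

variable {d : Type*} [Fintype d] [DecidableEq d]

/-- **Slope lower bound.** For a global Leray–Hopf solution on `T^d` with steady smooth
divergence-free force, `1/3 < σ ≤ 1`, `0 < ν ≤ (1/4)^{σ+1}`, long-time mean dissipation at least
`ε`, and `‖u‖³_{L³(0,T;B^σ_{3,∞})} ≤ AT + B` for all `T > 0` with `A ≥ 0`:
`ε ν^{-(3σ-1)/(σ+1)} ≤ K₀ + K₁ A`. [cite: DrivasEyink2019, Lemma 1] -/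
theorem lerayHopf_besov_slope_lower_bound {ν σ A B ε : ℝ} (hσ : 1 / 3 < σ ∧ σ ≤ 1) (hν : 0 < ν)
    (hν' : ν ≤ (1 / 4 : ℝ) ^ (σ + 1)) (hA : 0 ≤ A)
    {f : UnitAddTorus d → EuclideanSpace ℝ d} (hf : Torus.IsSmooth f) (hdiv : Torus.IsDivFree f)
    {u₀ : UnitAddTorus d → EuclideanSpace ℝ d} {u : ℝ → UnitAddTorus d → EuclideanSpace ℝ d}
    (hu : Torus.IsGlobalLerayHopf ν (fun _ => f) u₀ u) (hε : ε ≤ meanDissipation ν u)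
    (hreg : ∀ T, 0 < T → MemLpBesovSup 3 σ 3 u volume (Ioo 0 T) ∧
      (eLpBesovSupNorm 3 σ 3 u volume (Ioo 0 T)).toReal ^ 3 ≤ A * T + B) :
    ε * ν ^ (-((3 * σ - 1) / (σ + 1))) ≤
      ((Fintype.card d : ℝ) ^ 2 * FunctionSpaces.Torus.gradProfileMass d ^ 2 +
          2 * (Fintype.card d : ℝ) * (eBesovSupNorm σ 2 f volume).toReal) +
        (2 * (Fintype.card d : ℝ) ^ 2 * FunctionSpaces.Torus.gradProfileMass d +
          (Fintype.card d : ℝ) ^ 2 * FunctionSpaces.Torus.gradProfileMass d ^ 2 +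
          2 * (Fintype.card d : ℝ) * (eBesovSupNorm σ 2 f volume).toReal) * A := by
  set p : ℝ := (3 * σ - 1) / (σ + 1) with hp
  have key := lerayHopf_meanDissipation_le_rpow' hσ hν hν' hA hf hdiv hu hreg
  have hνp : 0 < ν ^ p := Real.rpow_pos_of_pos hν _
  have h1 : ε ≤ ((Fintype.card d : ℝ) ^ 2 * (2 * FunctionSpaces.Torus.gradProfileMass d) * A +
        (Fintype.card d : ℝ) ^ 2 * FunctionSpaces.Torus.gradProfileMass d ^ 2 * (1 + A) +
        2 * (Fintype.card d : ℝ) * (eBesovSupNorm σ 2 f volume).toReal * (1 + A)) * ν ^ p :=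
    hε.trans key
  have h2 : ε * ν ^ (-p) ≤ ((Fintype.card d : ℝ) ^ 2 * (2 * FunctionSpaces.Torus.gradProfileMass d) * A +
        (Fintype.card d : ℝ) ^ 2 * FunctionSpaces.Torus.gradProfileMass d ^ 2 * (1 + A) +
        2 * (Fintype.card d : ℝ) * (eBesovSupNorm σ 2 f volume).toReal * (1 + A)) := by
    have hinv : ν ^ (-p) = (ν ^ p)⁻¹ := Real.rpow_neg hν.le p
    rw [hinv, ← div_eq_mul_inv, div_le_iff₀ hνp]
    exact h1
  calc ε * ν ^ (-p) ≤ _ := h2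
    _ = _ := by ring

/-- **Eventual excess over every small slope.** In the situation of
`lerayHopf_besov_slope_lower_bound`, for every slope `A` with `K₀ + K₁ max(A,0) < ε ν^{-(3σ-1)/(σ+1)}`
and every `B` there is `T > 0` with `u ∉ L³(0,T;B^σ_{3,∞})` or `‖u‖³_{L³(0,T;B^σ_{3,∞})} > AT + B`.
Along a witness of the zeroth law (`ε > 0` fixed, `ν_j → 0`) the admissible slopes therefore grow at
least like `(ε ν_j^{-(3σ-1)/(σ+1)} - K₀)/K₁`. [cite: DrivasEyink2019, Lemma 1] -/
theorem lerayHopf_eventually_exceeds_slope {ν σ ε : ℝ} (hσ : 1 / 3 < σ ∧ σ ≤ 1) (hν : 0 < ν)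
    (hν' : ν ≤ (1 / 4 : ℝ) ^ (σ + 1))
    {f : UnitAddTorus d → EuclideanSpace ℝ d} (hf : Torus.IsSmooth f) (hdiv : Torus.IsDivFree f)
    {u₀ : UnitAddTorus d → EuclideanSpace ℝ d} {u : ℝ → UnitAddTorus d → EuclideanSpace ℝ d}
    (hu : Torus.IsGlobalLerayHopf ν (fun _ => f) u₀ u) (hε : ε ≤ meanDissipation ν u) {A : ℝ}
    (hA : ((Fintype.card d : ℝ) ^ 2 * FunctionSpaces.Torus.gradProfileMass d ^ 2 +
          2 * (Fintype.card d : ℝ) * (eBesovSupNorm σ 2 f volume).toReal) +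
        (2 * (Fintype.card d : ℝ) ^ 2 * FunctionSpaces.Torus.gradProfileMass d +
          (Fintype.card d : ℝ) ^ 2 * FunctionSpaces.Torus.gradProfileMass d ^ 2 +
          2 * (Fintype.card d : ℝ) * (eBesovSupNorm σ 2 f volume).toReal) * max A 0 <
      ε * ν ^ (-((3 * σ - 1) / (σ + 1)))) (B : ℝ) :
    ∃ T : ℝ, 0 < T ∧ (MemLpBesovSup 3 σ 3 u volume (Ioo 0 T) →
      A * T + B < (eLpBesovSupNorm 3 σ 3 u volume (Ioo 0 T)).toReal ^ 3) := by
  by_contra hnot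
  push Not at hnot
  have hreg : ∀ T, 0 < T → MemLpBesovSup 3 σ 3 u volume (Ioo 0 T) ∧
      (eLpBesovSupNorm 3 σ 3 u volume (Ioo 0 T)).toReal ^ 3 ≤ max A 0 * T + B := by
    intro T hT
    obtain ⟨hm, hle⟩ := hnot T hT
    exact ⟨hm, hle.trans (add_le_add (mul_le_mul_of_nonneg_right (le_max_left _ _) hT.le) le_rfl)⟩
  have h := lerayHopf_besov_slope_lower_bound hσ hν hν' (le_max_right A 0) hf hdiv hu hε hreg
  exact absurd hA (not_lt.2 h)

end Summit.AnomalousDissipation.AnomalousDissipation.Theorems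

end
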